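import Summits.Ventures.PercRepro.S1CFGDepFour
import Summits.Ventures.PercRepro.S1CFGTrianglesChainValues

/-!
# PercRepro — THE SIMPLE CHAIN WITH THE DEPENDENT-`4`-SET CAP AT NULLITY `4`, BY NUMBER (p1, gen 40)

The low-rank set counts of a SIMPLE coloop-free matroid of nullity `4` on `n = 10 … 13` points with the cap
`D₄ ≤ C(5, 4) + (n − 5)·C(5, 3) + C(5, 2) + (n − 3) = 10n − 28` (S1CFGDepFour) propagated through the landed double
counts: `(c₃, Q₄², c₄, D₄, Q₅², Q₅³, Q₅⁴)` at `n = 10`: `(11, 5, 25, 72, 1, 34, 169)` · `11`: `(11, 5, 23, 83, 1, 40, 264)` ·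
`12`: `(11, 5, 22, 94, 1, 45, 391)` · `13`: `(11, 5, 21, 105, 1, 51, 555)` — the simple sub-case of the nullity-`4`
contraction residual (the rank-`6` split of the `ν = 4` regimes of the rows `p = 11, 12, 13` at `q = 5`: the cell's
`D₄ ≤ 20(n − 3) + 35` there). Nothing about any cell is claimed. Axioms: standard.
-/

open scoped Matroid

namespace PercRepro

namespace S1CFG

open Set S1CF

variable {α : Type}

/-- **The chain with the `D₄` cap at `(ν, n) = (4, 10)`**: `c₃ ≤ 11`, `Q₄² ≤ 5`, `c₄ ≤ 25`, `D₄ ≤ 72`, `Q₅² ≤ 1`,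
`Q₅³ ≤ 34`, `Q₅⁴ ≤ 169`. -/
theorem depchain_four_ten (M : Matroid α) [M.Finite] (hK : ∀ e, ¬ M.IsColoop e)
    (hd : M.E.encard = M.eRank + ((4 : ℕ) : ℕ∞))
    (h0 : {P : Set α | P ⊆ M.E ∧ P.ncard = 2 ∧ M.Dep P}.ncard = 0) (hn : M.E.ncard = 10) :
    {X : Set α | X ⊆ M.E ∧ X.ncard = 3 ∧ M.eRk X ≤ 2}.ncard ≤ 11 ∧
    {X : Set α | X ⊆ M.E ∧ X.ncard = 4 ∧ M.eRk X ≤ 2}.ncard ≤ 5 ∧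
    {X : Set α | X ⊆ M.E ∧ X.ncard = 4 ∧ M.IsCircuit X}.ncard ≤ 25 ∧
    {X : Set α | X ⊆ M.E ∧ X.ncard = 4 ∧ M.eRk X ≤ 3}.ncard ≤ 72 ∧
    {X : Set α | X ⊆ M.E ∧ X.ncard = 5 ∧ M.eRk X ≤ 2}.ncard ≤ 1 ∧
    {X : Set α | X ⊆ M.E ∧ X.ncard = 5 ∧ M.eRk X ≤ 3}.ncard ≤ 34 ∧
    {X : Set α | X ⊆ M.E ∧ X.ncard = 5 ∧ M.eRk X ≤ 4}.ncard ≤ 169 := by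
  have hr : (M.eRk M.E).toNat = 6 := by
    have := ncard_ground_eq_eRk_toNat_add M hd
    omega
  have h3 := ncard_three_eRk_le_two_le_choose_succ_add_one'' M hd hK h0 (by norm_num) (by omega)
  have h42 := four_mul_ncard_four_eRk_le_two_le_mul M hK hd h0 (by omega)
  have h4 := ncard_fourCircuits_le_div M hK hd (by omega)
  have h4' : {X : Set α | X ⊆ M.E ∧ X.ncard = 4 ∧ M.IsCircuit X}.ncard ≤ 25 := by
    rw [hn] at h4
    exact h4.trans (by decide)
  have hD4 := ncard_four_eRk_le_three_le_cap M hd hK h0 (by norm_num)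
  have h52 := five_mul_ncard_five_eRk_le_two_le_of_no_dep_pair M hK hd h0 (by omega)
  have h53 := five_mul_ncard_five_eRk_le_three_le M hK hd (by omega)
  have h54 := five_mul_ncard_five_eRk_le_four_le_exact M hK hd (by omega)
  rw [hn] at hD4 h53 h54
  rw [show Nat.choose 10 4 = 210 by decide] at h54
  simp only [show (4 + 1).choose 4 = 5 by decide, show (4 + 1).choose 3 = 10 by decide,
    show (4 + 1).choose 2 = 10 by decide] at hD4 h3
  omega

/-- **The chain with the `D₄` cap at `(ν, n) = (4, 11)`**: `c₃ ≤ 11`, `Q₄² ≤ 5`, `c₄ ≤ 23`, `D₄ ≤ 83`, `Q₅² ≤ 1`,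
`Q₅³ ≤ 40`, `Q₅⁴ ≤ 264`. -/
theorem depchain_four_eleven (M : Matroid α) [M.Finite] (hK : ∀ e, ¬ M.IsColoop e)
    (hd : M.E.encard = M.eRank + ((4 : ℕ) : ℕ∞))
    (h0 : {P : Set α | P ⊆ M.E ∧ P.ncard = 2 ∧ M.Dep P}.ncard = 0) (hn : M.E.ncard = 11) :
    {X : Set α | X ⊆ M.E ∧ X.ncard = 3 ∧ M.eRk X ≤ 2}.ncard ≤ 11 ∧
    {X : Set α | X ⊆ M.E ∧ X.ncard = 4 ∧ M.eRk X ≤ 2}.ncard ≤ 5 ∧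
    {X : Set α | X ⊆ M.E ∧ X.ncard = 4 ∧ M.IsCircuit X}.ncard ≤ 23 ∧
    {X : Set α | X ⊆ M.E ∧ X.ncard = 4 ∧ M.eRk X ≤ 3}.ncard ≤ 83 ∧
    {X : Set α | X ⊆ M.E ∧ X.ncard = 5 ∧ M.eRk X ≤ 2}.ncard ≤ 1 ∧
    {X : Set α | X ⊆ M.E ∧ X.ncard = 5 ∧ M.eRk X ≤ 3}.ncard ≤ 40 ∧
    {X : Set α | X ⊆ M.E ∧ X.ncard = 5 ∧ M.eRk X ≤ 4}.ncard ≤ 264 := by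
  have hr : (M.eRk M.E).toNat = 7 := by
    have := ncard_ground_eq_eRk_toNat_add M hd
    omega
  have h3 := ncard_three_eRk_le_two_le_choose_succ_add_one'' M hd hK h0 (by norm_num) (by omega)
  have h42 := four_mul_ncard_four_eRk_le_two_le_mul M hK hd h0 (by omega)
  have h4 := ncard_fourCircuits_le_div M hK hd (by omega)
  have h4' : {X : Set α | X ⊆ M.E ∧ X.ncard = 4 ∧ M.IsCircuit X}.ncard ≤ 23 := by
    rw [hn] at h4
    exact h4.trans (by decide)
  have hD4 := ncard_four_eRk_le_three_le_cap M hd hK h0 (by norm_num)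
  have h52 := five_mul_ncard_five_eRk_le_two_le_of_no_dep_pair M hK hd h0 (by omega)
  have h53 := five_mul_ncard_five_eRk_le_three_le M hK hd (by omega)
  have h54 := five_mul_ncard_five_eRk_le_four_le_exact M hK hd (by omega)
  rw [hn] at hD4 h53 h54
  rw [show Nat.choose 11 4 = 330 by decide] at h54
  simp only [show (4 + 1).choose 4 = 5 by decide, show (4 + 1).choose 3 = 10 by decide,
    show (4 + 1).choose 2 = 10 by decide] at hD4 h3
  omega

/-- **The chain with the `D₄` cap at `(ν, n) = (4, 12)`**: `c₃ ≤ 11`, `Q₄² ≤ 5`, `c₄ ≤ 22`, `D₄ ≤ 94`, `Q₅² ≤ 1`,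
`Q₅³ ≤ 45`, `Q₅⁴ ≤ 391`. -/
theorem depchain_four_twelve (M : Matroid α) [M.Finite] (hK : ∀ e, ¬ M.IsColoop e)
    (hd : M.E.encard = M.eRank + ((4 : ℕ) : ℕ∞))
    (h0 : {P : Set α | P ⊆ M.E ∧ P.ncard = 2 ∧ M.Dep P}.ncard = 0) (hn : M.E.ncard = 12) :
    {X : Set α | X ⊆ M.E ∧ X.ncard = 3 ∧ M.eRk X ≤ 2}.ncard ≤ 11 ∧
    {X : Set α | X ⊆ M.E ∧ X.ncard = 4 ∧ M.eRk X ≤ 2}.ncard ≤ 5 ∧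
    {X : Set α | X ⊆ M.E ∧ X.ncard = 4 ∧ M.IsCircuit X}.ncard ≤ 22 ∧
    {X : Set α | X ⊆ M.E ∧ X.ncard = 4 ∧ M.eRk X ≤ 3}.ncard ≤ 94 ∧
    {X : Set α | X ⊆ M.E ∧ X.ncard = 5 ∧ M.eRk X ≤ 2}.ncard ≤ 1 ∧
    {X : Set α | X ⊆ M.E ∧ X.ncard = 5 ∧ M.eRk X ≤ 3}.ncard ≤ 45 ∧
    {X : Set α | X ⊆ M.E ∧ X.ncard = 5 ∧ M.eRk X ≤ 4}.ncard ≤ 391 := by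
  have hr : (M.eRk M.E).toNat = 8 := by
    have := ncard_ground_eq_eRk_toNat_add M hd
    omega
  have h3 := ncard_three_eRk_le_two_le_choose_succ_add_one'' M hd hK h0 (by norm_num) (by omega)
  have h42 := four_mul_ncard_four_eRk_le_two_le_mul M hK hd h0 (by omega)
  have h4 := ncard_fourCircuits_le_div M hK hd (by omega)
  have h4' : {X : Set α | X ⊆ M.E ∧ X.ncard = 4 ∧ M.IsCircuit X}.ncard ≤ 22 := by
    rw [hn] at h4
    exact h4.trans (by decide)
  have hD4 := ncard_four_eRk_le_three_le_cap M hd hK h0 (by norm_num)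
  have h52 := five_mul_ncard_five_eRk_le_two_le_of_no_dep_pair M hK hd h0 (by omega)
  have h53 := five_mul_ncard_five_eRk_le_three_le M hK hd (by omega)
  have h54 := five_mul_ncard_five_eRk_le_four_le_exact M hK hd (by omega)
  rw [hn] at hD4 h53 h54
  rw [show Nat.choose 12 4 = 495 by decide] at h54
  simp only [show (4 + 1).choose 4 = 5 by decide, show (4 + 1).choose 3 = 10 by decide,
    show (4 + 1).choose 2 = 10 by decide] at hD4 h3
  omega

/-- **The chain with the `D₄` cap at `(ν, n) = (4, 13)`**: `c₃ ≤ 11`, `Q₄² ≤ 5`, `c₄ ≤ 21`, `D₄ ≤ 105`, `Q₅² ≤ 1`,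
`Q₅³ ≤ 51`, `Q₅⁴ ≤ 555`. -/
theorem depchain_four_thirteen (M : Matroid α) [M.Finite] (hK : ∀ e, ¬ M.IsColoop e)
    (hd : M.E.encard = M.eRank + ((4 : ℕ) : ℕ∞))
    (h0 : {P : Set α | P ⊆ M.E ∧ P.ncard = 2 ∧ M.Dep P}.ncard = 0) (hn : M.E.ncard = 13) :
    {X : Set α | X ⊆ M.E ∧ X.ncard = 3 ∧ M.eRk X ≤ 2}.ncard ≤ 11 ∧
    {X : Set α | X ⊆ M.E ∧ X.ncard = 4 ∧ M.eRk X ≤ 2}.ncard ≤ 5 ∧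
    {X : Set α | X ⊆ M.E ∧ X.ncard = 4 ∧ M.IsCircuit X}.ncard ≤ 21 ∧
    {X : Set α | X ⊆ M.E ∧ X.ncard = 4 ∧ M.eRk X ≤ 3}.ncard ≤ 105 ∧
    {X : Set α | X ⊆ M.E ∧ X.ncard = 5 ∧ M.eRk X ≤ 2}.ncard ≤ 1 ∧
    {X : Set α | X ⊆ M.E ∧ X.ncard = 5 ∧ M.eRk X ≤ 3}.ncard ≤ 51 ∧
    {X : Set α | X ⊆ M.E ∧ X.ncard = 5 ∧ M.eRk X ≤ 4}.ncard ≤ 555 := by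
  have hr : (M.eRk M.E).toNat = 9 := by
    have := ncard_ground_eq_eRk_toNat_add M hd
    omega
  have h3 := ncard_three_eRk_le_two_le_choose_succ_add_one'' M hd hK h0 (by norm_num) (by omega)
  have h42 := four_mul_ncard_four_eRk_le_two_le_mul M hK hd h0 (by omega)
  have h4 := ncard_fourCircuits_le_div M hK hd (by omega)
  have h4' : {X : Set α | X ⊆ M.E ∧ X.ncard = 4 ∧ M.IsCircuit X}.ncard ≤ 21 := by
    rw [hn] at h4
    exact h4.trans (by decide)
  have hD4 := ncard_four_eRk_le_three_le_cap M hd hK h0 (by norm_num)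
  have h52 := five_mul_ncard_five_eRk_le_two_le_of_no_dep_pair M hK hd h0 (by omega)
  have h53 := five_mul_ncard_five_eRk_le_three_le M hK hd (by omega)
  have h54 := five_mul_ncard_five_eRk_le_four_le_exact M hK hd (by omega)
  rw [hn] at hD4 h53 h54
  rw [show Nat.choose 13 4 = 715 by decide] at h54
  simp only [show (4 + 1).choose 4 = 5 by decide, show (4 + 1).choose 3 = 10 by decide,
    show (4 + 1).choose 2 = 10 by decide] at hD4 h3
  omega

end S1CFG

end PercRepro
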